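import Mathlib

/-!
# The shifted blocks are pairwise disjoint (`stub_blockCount`)

A *letter* is `l : Fin 3 × Fin 3 × ℂ × Option (Fin n × Fin n)`; `l.2.2.2 = some v` means the
letter reads the variable `x_v`, `v = (row, col)`.  The shifted blocks are
`S_{k,c} = {v : v.2 = v.1 + k ∧ c·b ≤ ↑v.1 < (c+1)·b}` for `k : Fin n` (addition in `Fin n`) and
`c < q`.  A variable lies in at most one block: `k` is forced because addition in `Fin n` is
cancellative, and `c` is forced because the intervals `[c·b, (c+1)·b)` are pairwise disjoint.
Hence the number of letters of a word reading a variable of `S_{k,c}`, summed over all `(k, c)`,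
is at most the length of the word.
-/

set_option linter.dupNamespace false

namespace Summit.ValiantsHypothesis.ValiantsHypothesis.Theorems.WordPerSuperQuartic

/-- A single letter is counted by at most one block `S_{k,c}`. -/
private theorem blockCount_letter (n b q : ℕ) (l : Fin 3 × Fin 3 × ℂ × Option (Fin n × Fin n)) :
    ∑ k : Fin n, ∑ c ∈ Finset.range q,
      (if l.2.2.2.any (fun v =>
        decide (v.2 = v.1 + k ∧ c * b ≤ (v.1 : ℕ) ∧ (v.1 : ℕ) < (c + 1) * b)) = true
        then 1 else 0) ≤ 1 := by
  obtain ⟨i, j, z, _ | v⟩ := l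
  · simp
  · simp only [Option.any_some, decide_eq_true_eq]
    rw [← Finset.sum_product', Finset.sum_boole, Nat.cast_id]
    refine Finset.card_le_one.2 ?_
    simp only [Finset.mem_filter, Finset.mem_product, Finset.mem_univ, Finset.mem_range,
      true_and]
    rintro ⟨k, c⟩ ⟨-, hk, hc1, hc2⟩ ⟨k', c'⟩ ⟨-, hk', hc1', hc2'⟩
    have hkk : k = k' := add_left_cancel (hk.symm.trans hk')
    have h1 : c < c' + 1 := Nat.lt_of_mul_lt_mul_right (lt_of_le_of_lt hc1 hc2')
    have h2 : c' < c + 1 := Nat.lt_of_mul_lt_mul_right (lt_of_le_of_lt hc1' hc2)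
    have hcc : c = c' := by omega
    rw [hkk, hcc]

/-- S5 — **the blocks are disjoint**: a letter reads a variable of at most one block `S_{k,c}`
(`k = v.2 - v.1`, `c = v.1 / b`), so the block letter counts, summed over all `k : Fin n` and
`c < q`, total at most the length of the word. -/
theorem stub_blockCount (n b q : ℕ)
    (w : List (Fin 3 × Fin 3 × ℂ × Option (Fin n × Fin n))) :
    ∑ k : Fin n, ∑ c ∈ Finset.range q,
      w.countP (fun l => l.2.2.2.any (fun v =>
        decide (v.2 = v.1 + k ∧ c * b ≤ (v.1 : ℕ) ∧ (v.1 : ℕ) < (c + 1) * b))) ≤ w.length := by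
  induction w with
  | nil => simp
  | cons l w ih =>
    have hl := blockCount_letter n b q l
    simp only [List.countP_cons, Finset.sum_add_distrib, List.length_cons]
    omega

end Summit.ValiantsHypothesis.ValiantsHypothesis.Theorems.WordPerSuperQuartic
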